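import Summits.BirchSwinnertonDyer.BirchSwinnertonDyer.Theorems.ByReductionTypeAtTwoRankOneAtTwoOffBigImageOddLocalEngineKolyvaginRelationShell
import HarnessLib

/-!
# Route `ByReductionTypeAtTwo`, crux `RankOneAtTwoOffBigImageOddLocal` (stmt-BirchSwinnertonDyer-23716), line
# `refined_kolyvagin_tamagawa_shift_at_two` — ENGINE PORT, card E4-γ: McCallum's Prop. 4.4 at `λ` for `p = 2` in the REGULAR case (equal valuations)

Lead prover `prover-cruxlead-stmt-BirchSwinnertonDyer-23716-g2` (2026-08-28).  Companion of `…EngineKolyvaginRelationShell.lean` (coprime case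
`v₂(a_ℓ) ≠ v₂(ℓ+1)`, any Frobenius).  Here: the EQUAL-VALUATION case `v₂(a_ℓ) = v₂(ℓ+1) = M` — the only Kolyvagin primes at `2` at which the
Frobenius TYPE matters — where Prop. 4.4 (2) «`ker χ_ℓ = 2^M Ẽ(F_λ)`» is supplied by the REGULAR (`ℤ[Frob]`-cyclic) structure of the `2`-primary part
`Ẽ(𝔽_{ℓ²})[2^∞] ≅ ℤ₂[φ]/2^M(l' - a'φ)` (`KolyvaginChiTwo.sub_eq_zero_iff_exists_pow_zsmul_eq_of_relations`), after splitting off the odd part of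
`Ẽ(F_λ) = {φ² = 1}` (on which `χ` is automatically compatible: an odd-order element is `2^M`-divisible, and `χ` of it has odd order).

* `kerChi_two_of_relations` — `hχ` of the tree's `p`-free shell `SylvesterTwoUpper.…_of_kerChi` at `p = 2`, from: `{φ² = 1}` torsion, the characteristic
  relation, `a'² ≠ l'²` (Hasse), and a `ℤ[φ]`-generator `g` of the `2`-primary part of `{φ² = 1}` with the regular relation lattice (odd saturation of
  `⟨(2^M l', -2^M a'), (-2^M a', 2^M l')⟩`).
* `zsmul_kolyvaginClass_mem_selmerLocalKer_iff_mem_torsionLocalKer_two_of_relations` — McCallum Prop. 4.4 at `λ` for `p = 2` from the abstract reduction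
  datum, regular case: «`k c_M(mℓ)` Selmer at `λ` iff `k c_M(m)_λ = 0`».

With the coprime case this covers EVERY Kolyvagin prime at `2` whose Frobenius is regular on `E[2]` (and every sharp prime regardless of type): the local
Kolyvagin relation (sibling crux `KolyvaginRelationAtTwo`, stmt-BirchSwinnertonDyer-24880, «McCallum 4.4 with `p := 2`») holds there modulo the same abstract
reduction datum the tree's odd-`p` theorem is stated over plus the named `2`-primary structure of `Ẽ(𝔽_{ℓ²})`.  Nothing here proves the crux, `BSDp W 2`, BSD or
the summit; no registered stub is discharged.  BSD is not proved.

Refs: [McCallumLMS1991] §4 Prop. 4.4 and proof; [GrossLMS1991] §6 Prop. 6.2 (2).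
-/

set_option linter.dupNamespace false -- tree convention: `Summit.BirchSwinnertonDyer.BirchSwinnertonDyer.Theorems` (summit = sub-problem)
set_option autoImplicit false

noncomputable section

namespace Summit.BirchSwinnertonDyer.BirchSwinnertonDyer.Theorems.OffBigImageOddLocalAtTwo.Engine

open scoped Classical
open WeierstrassCurve NumberField IsDedekindDomain Field Finset
open Literature.NumberTheory.GaloisRepresentations Literature.NumberTheory.EllipticCurves
open Literature.NumberTheory.EllipticCurves.KolyvaginCocycle

universe u

section RegularCase

/-- **`ker χ_ℓ = 2^M Ẽ(F_λ)` in the shell's `B`-form, REGULAR (equal-valuation) case.**  `φ` additive on `B`, every element of `B₀ = {φ² = 1}` of finite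
order, the characteristic relation `(ℓ+1) b = a φ(b)` on `B₀` (`ℓ + 1 = 2^M l'`, `a = 2^M a'`), `a'² ≠ l'²`, and the `2`-primary part of `B₀` CYCLIC over
`ℤ[φ]` with generator `g` and the regular relation lattice.  Then for `b ∈ B₀`: `a' b - l' φ(b) = 0 ↔ ∃ y ∈ B₀, 2^M y = b`.  Proof: split `b = y + z`
into its `2`-primary and odd parts (multiples of `b`); `χ(b) = 0` forces `χ(y) = 0 = χ(z)` (coprime orders); `z` is `2^M`-divisible inside `ℤ z`;
`y` is `2^M`-divisible inside the `2`-primary part by `KolyvaginChiTwo.sub_eq_zero_iff_exists_pow_zsmul_eq_of_relations`. [cite: McCallumLMS1991, Prop. 4.4 (2)] -/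
theorem kerChi_two_of_relations {B : Type*} [AddCommGroup B] (φ : B →+ B)
    (htors : ∀ b : B, φ (φ b) = b → IsOfFinAddOrder b)
    {M ℓ : ℕ} {a l' a' : ℤ} (hl' : ((ℓ + 1 : ℕ) : ℤ) = (2 : ℤ) ^ M * l') (ha' : a = (2 : ℤ) ^ M * a')
    (hchar : ∀ b : B, φ (φ b) = b → ((ℓ + 1 : ℕ) : ℤ) • b = a • φ b)
    (hne : a' ^ 2 ≠ l' ^ 2)
    {g : B} (hg : φ (φ g) = g) (hg2 : ∃ k : ℕ, ((2 : ℤ) ^ k) • g = 0)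
    (hgen : ∀ c : B, φ (φ c) = c → (∃ k : ℕ, ((2 : ℤ) ^ k) • c = 0) → ∃ i j : ℤ, c = i • g + j • φ g)
    (hrel : ∀ i j : ℤ, i • g + j • φ g = 0 → ∃ k x y : ℤ, Odd k ∧
      k * i = 2 ^ M * (l' * x - a' * y) ∧ k * j = 2 ^ M * (l' * y - a' * x))
    (b : B) (hb : φ (φ b) = b) :
    a' • b - l' • φ b = 0 ↔ ∃ y : B, φ (φ y) = y ∧ ((2 : ℤ) ^ M) • y = b := by
  -- the characteristic relation in primed form, and `2^M χ = 0` on `B₀`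
  have hchar' : ∀ c : B, φ (φ c) = c → ((2 : ℤ) ^ M * l') • c = ((2 : ℤ) ^ M * a') • φ c := fun c hc ↦ by
    rw [← hl', ← ha']; exact hchar c hc
  have hφφ_zsmul : ∀ (n : ℤ) (c : B), φ (φ c) = c → φ (φ (n • c)) = n • c := fun n c hc ↦ by
    rw [map_zsmul, map_zsmul, hc]
  constructor
  swap
  · rintro ⟨y, hy, rfl⟩
    have h := hchar' (φ y) (by rw [hy])
    rw [hy] at h
    rw [map_zsmul, smul_comm a', smul_comm l' ((2 : ℤ) ^ M), ← zsmul_sub, zsmul_sub, smul_smul, smul_smul, ← h, sub_self]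
  intro hχb
  -- `2`-primary decomposition `b = y + z`
  obtain ⟨y, z, k, m, hbyz, hy, hz, hcop⟩ := KolyvaginChi.exists_primary_add Nat.prime_two (htors b hb)
  simp only [Nat.cast_ofNat] at hy hcop
  -- `y`, `z` need not be the Bézout multiples of `b`; rebuild the split from Bézout so that both pieces are multiples of `b` (hence in `B₀`)
  obtain ⟨α, β, hαβ⟩ := (hcop.pow_left (m := k))
  set y' : B := (β * m) • b with hy'def
  set z' : B := (α * (2 : ℤ) ^ k) • b with hz'def
  have hbyz' : b = y' + z' := by
    rw [hy'def, hz'def, ← add_zsmul, show β * m + α * (2 : ℤ) ^ k = 1 by rw [add_comm]; exact hαβ, one_zsmul]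
  have hmb : ((2 : ℤ) ^ k * m) • b = 0 := by
    have h1 : ((2 : ℤ) ^ k * m) • y = 0 := by rw [mul_comm, mul_zsmul, hy, zsmul_zero]
    have h2 : ((2 : ℤ) ^ k * m) • z = 0 := by rw [mul_zsmul, hz, zsmul_zero]
    rw [hbyz, zsmul_add, h1, h2, add_zero]
  have hy' : ((2 : ℤ) ^ k) • y' = 0 := by
    rw [hy'def, smul_smul, show (2 : ℤ) ^ k * (β * m) = β * ((2 : ℤ) ^ k * m) by ring, mul_zsmul, hmb, zsmul_zero]
  have hz' : m • z' = 0 := by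
    rw [hz'def, smul_smul, show m * (α * (2 : ℤ) ^ k) = α * ((2 : ℤ) ^ k * m) by ring, mul_zsmul, hmb, zsmul_zero]
  have hy'B : φ (φ y') = y' := hφφ_zsmul _ b hb
  have hz'B : φ (φ z') = z' := hφφ_zsmul _ b hb
  -- `χ` on the pieces
  set χ : B → B := fun c ↦ a' • c - l' • φ c with hχdef
  have hχadd : χ b = χ y' + χ z' := by
    simp only [hχdef]; rw [hbyz', map_add, zsmul_add, zsmul_add]; abel
  have hχzsmul : ∀ (n : ℤ) (c : B), χ (n • c) = n • χ c := fun n c ↦ by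
    simp only [hχdef]; rw [map_zsmul, zsmul_sub, smul_comm a' n, smul_comm l' n]
  have hχy2 : ((2 : ℤ) ^ k) • χ y' = 0 := by rw [← hχzsmul, hy']; simp [hχdef]
  have hχzm : m • χ z' = 0 := by rw [← hχzsmul, hz']; simp [hχdef]
  have hχy0 : χ y' = 0 := by
    have h1 : χ y' = -χ z' := by
      have : χ y' + χ z' = 0 := by rw [← hχadd]; exact hχb
      exact eq_neg_of_add_eq_zero_left this
    have hm' : m • χ y' = 0 := by rw [h1, zsmul_neg, hχzm, neg_zero]
    exact KolyvaginChi.eq_zero_of_zsmul_eq_zero_of_isCoprime (hcop.pow_left (m := k)) hχy2 hm'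
  -- the odd part is `2^M`-divisible inside `ℤ z'` (Bézout), by a multiple of `z'` (hence in `B₀`)
  obtain ⟨γ, δ, hγδ⟩ := (hcop.pow_left (m := M))
  set z₂ : B := γ • z' with hz₂def
  have hz₂ : ((2 : ℤ) ^ M) • z₂ = z' := by
    have h0 : (δ * m) • z' = 0 := by rw [mul_zsmul, hz', zsmul_zero]
    rw [hz₂def, smul_smul, show (2 : ℤ) ^ M * γ = γ * (2 : ℤ) ^ M by ring]
    calc (γ * (2 : ℤ) ^ M) • z' = (γ * (2 : ℤ) ^ M) • z' + (δ * m) • z' := by rw [h0, add_zero]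
      _ = z' := by rw [← add_zsmul, hγδ, one_zsmul]
  have hz₂B : φ (φ z₂) = z₂ := by rw [hz₂def]; exact hφφ_zsmul _ _ hz'B
  -- the `2`-primary part: the subgroup `C₂ = {c ∈ B₀ | 2^∞-torsion}` and `χ` on it
  set C₂ : AddSubgroup B :=
    { carrier := {c | φ (φ c) = c ∧ ∃ n : ℕ, ((2 : ℤ) ^ n) • c = 0}
      zero_mem' := ⟨by simp, ⟨0, by simp⟩⟩
      add_mem' := by
        rintro c d ⟨hc, n₁, hn₁⟩ ⟨hd, n₂, hn₂⟩
        refine ⟨by rw [map_add, map_add, hc, hd], n₁ + n₂, ?_⟩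
        rw [zsmul_add, pow_add, mul_comm, mul_zsmul, hn₁, zsmul_zero, zero_add, mul_comm, mul_zsmul, hn₂, zsmul_zero]
      neg_mem' := by
        rintro c ⟨hc, n, hn⟩
        exact ⟨by rw [map_neg, map_neg, hc], n, by rw [zsmul_neg, hn, neg_zero]⟩ } with hC₂def
  have hmemC₂ : ∀ {c : B}, c ∈ C₂ ↔ φ (φ c) = c ∧ ∃ n : ℕ, ((2 : ℤ) ^ n) • c = 0 := fun {c} ↦ Iff.rfl
  have hφC₂ : ∀ c ∈ C₂, φ c ∈ C₂ := by
    rintro c ⟨hc, n, hn⟩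
    exact ⟨by rw [hc], n, by rw [← map_zsmul, hn, map_zero]⟩
  set φ₂ : C₂ →+ C₂ := (φ.comp C₂.subtype).codRestrict C₂ (fun c ↦ hφC₂ c c.2) with hφ₂def
  have hφ₂ : ∀ c : C₂, (φ₂ c : B) = φ c := fun c ↦ rfl
  have hφ₂inv : ∀ c : C₂, φ₂ (φ₂ c) = c := fun c ↦ Subtype.ext (by rw [hφ₂, hφ₂]; exact c.2.1)
  have hchar₂ : ∀ c : C₂, ((2 : ℤ) ^ M * l') • c = ((2 : ℤ) ^ M * a') • φ₂ c := fun c ↦ by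
    apply Subtype.ext
    rw [AddSubgroupClass.coe_zsmul, AddSubgroupClass.coe_zsmul, hφ₂]
    exact hchar' c c.2.1
  have h2C₂ : ∀ c : C₂, ∃ n : ℕ, ((2 : ℤ) ^ n) • c = 0 := fun c ↦ by
    obtain ⟨n, hn⟩ := c.2.2
    exact ⟨n, Subtype.ext (by rw [AddSubgroupClass.coe_zsmul]; exact hn)⟩
  have hgC₂ : g ∈ C₂ := ⟨hg, hg2⟩
  have hgenC₂ : ∀ c : C₂, ∃ i j : ℤ, c = i • (⟨g, hgC₂⟩ : C₂) + j • φ₂ ⟨g, hgC₂⟩ := fun c ↦ by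
    obtain ⟨i, j, hij⟩ := hgen c c.2.1 c.2.2
    exact ⟨i, j, Subtype.ext (by
      rw [AddSubgroup.coe_add, AddSubgroupClass.coe_zsmul, AddSubgroupClass.coe_zsmul, hφ₂]; exact hij)⟩
  have hrelC₂ : ∀ i j : ℤ, i • (⟨g, hgC₂⟩ : C₂) + j • φ₂ ⟨g, hgC₂⟩ = 0 → ∃ k x y : ℤ, Odd k ∧
      k * i = 2 ^ M * (l' * x - a' * y) ∧ k * j = 2 ^ M * (l' * y - a' * x) := fun i j hij ↦ by
    apply hrel i j
    have h := congrArg Subtype.val hij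
    rwa [AddSubgroup.coe_add, AddSubgroupClass.coe_zsmul, AddSubgroupClass.coe_zsmul, hφ₂] at h
  -- apply §2 to `y' ∈ C₂`
  have hy'C₂ : y' ∈ C₂ := ⟨hy'B, k, hy'⟩
  have hχy' : a' • (⟨y', hy'C₂⟩ : C₂) - l' • φ₂ ⟨y', hy'C₂⟩ = 0 := by
    apply Subtype.ext
    rw [AddSubgroupClass.coe_sub, AddSubgroupClass.coe_zsmul, AddSubgroupClass.coe_zsmul, hφ₂, AddSubgroup.coe_zero]
    exact hχy0
  obtain ⟨y₂, hy₂⟩ := (KolyvaginChiTwo.sub_eq_zero_iff_exists_pow_zsmul_eq_of_relations φ₂ hφ₂inv hne hchar₂ h2C₂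
    hgenC₂ hrelC₂ ⟨y', hy'C₂⟩).mp hχy'
  have hy₂' : ((2 : ℤ) ^ M) • (y₂ : B) = y' := by
    have h := congrArg Subtype.val hy₂
    rwa [AddSubgroupClass.coe_zsmul] at h
  refine ⟨(y₂ : B) + z₂, by rw [map_add, map_add, y₂.2.1, hz₂B], ?_⟩
  rw [zsmul_add, hy₂', hz₂, ← hbyz']

end RegularCase

section RamifiedTwoRegular

variable {K : Type u} [Field K] [NumberField K] (W : WeierstrassCurve K) [W.IsElliptic]

/-- **McCallum Prop. 4.4 at `λ` for `p = 2`, REGULAR (equal-valuation) case.**  Same abstract reduction datum at `λ` as the tree's odd-`p` theorem, with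
`p := 2`, `ℓ + 1 = 2^M l'`, `a = a_ℓ = 2^M a'`, `a'² ≠ l'²`, the characteristic relation and finiteness of orders on `Ẽ(F_λ) = {φ² = 1}`, and — in place
of the odd-`p` eigen-cyclicity `hcyc` — the REGULAR structure of the `2`-primary part of `Ẽ(F_λ)`: a `ℤ[φ]`-generator `g` with the regular relation
lattice.  Conclusion: for every `k ∈ ℤ`, `k c_M(mℓ)` is Selmer at `λ` iff `k c_M(m)_λ = 0`.  Proof: `SylvesterTwoUpper.…_of_kerChi` with `hχ` discharged by
`kerChi_two_of_relations`. [cite: McCallumLMS1991, Prop. 4.4] [cite: GrossLMS1991, Prop. 6.2 (2)] -/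
theorem zsmul_kolyvaginClass_mem_selmerLocalKer_iff_mem_torsionLocalKer_two_of_relations
    {M : ℕ}
    {hdiv : ∀ P : geomPoints W, ∃ Q : geomPoints W, ((2 ^ M : ℕ) : ℤ) • Q = P}
    {A₁ A₂ : AddSubgroup (geomPoints W)}
    (hA₁ : IsAdmissible (absoluteGaloisGroup K) A₁ ((2 ^ M : ℕ) : ℤ))
    (hA₂ : IsAdmissible (absoluteGaloisGroup K) A₂ ((2 ^ M : ℕ) : ℤ))
    {P₁ P₂ : geomPoints W}
    (hP₁ : P₁ ∈ invPoints (absoluteGaloisGroup K) A₁ ((2 ^ M : ℕ) : ℤ))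
    (hP₂ : P₂ ∈ invPoints (absoluteGaloisGroup K) A₂ ((2 ^ M : ℕ) : ℤ))
    -- the place `λ`
    {v : HeightOneSpectrum (𝓞 K)} (hgood : W.HasGoodReductionAt v) (hpv : (2 : 𝓞 K) ∉ v.asIdeal)
    {𝔐 : Ideal (HeightOneSpectrum.localAbsIntegers v)} (h𝔐 : 𝔐 ∈ v.localPrimesAbove)
    {F : absoluteGaloisGroup K}
    (hF : IsArithFrobAt (𝓞 K) F (v.primeBelow (closureEmb (K := K) (v.adicCompletion K)) 𝔐))
    (hFfix : F ∈ torsionFixing W ((2 ^ M : ℕ) : ℤ))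
    (hsurj : Function.Surjective (torsionPointsMap W (v.adicCompletion K) ((2 ^ M : ℕ) : ℤ)))
    -- the reduction datum at `𝔓`
    {B : Type*} [AddCommGroup B] (red : geomPoints W →+ B) (φ : B →+ B)
    (hredI : ∀ τ ∈ (v.primeBelow (closureEmb (K := K) (v.adicCompletion K)) 𝔐).inertia
      (absoluteGaloisGroup K), ∀ x : geomPoints W, red (τ • x) = red x)
    (hredF : ∀ x : geomPoints W, red (F • x) = φ (φ (red x)))
    (hred : ∀ x : geomPoints W, ((2 ^ M : ℕ) : ℤ) • x = 0 → red x = 0 → x = 0)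
    (hBn : ∀ b : B, ((2 ^ M : ℕ) : ℤ) • b = 0 → φ (φ b) = b)
    -- the arithmetic of `Ẽ(F_λ) = {φ² = 1}`, regular case
    (htors : ∀ b : B, φ (φ b) = b → IsOfFinAddOrder b)
    {ℓ : ℕ} {a l' a' : ℤ} (hl' : ((ℓ + 1 : ℕ) : ℤ) = (2 : ℤ) ^ M * l')
    (ha' : a = (2 : ℤ) ^ M * a')
    (hchar : ∀ b : B, φ (φ b) = b → ((ℓ + 1 : ℕ) : ℤ) • b = a • φ b)
    (hne : a' ^ 2 ≠ l' ^ 2)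
    {g : B} (hg : φ (φ g) = g) (hg2 : ∃ k : ℕ, ((2 : ℤ) ^ k) • g = 0)
    (hgen : ∀ c : B, φ (φ c) = c → (∃ k : ℕ, ((2 : ℤ) ^ k) • c = 0) → ∃ i j : ℤ, c = i • g + j • φ g)
    (hrel : ∀ i j : ℤ, i • g + j • φ g = 0 → ∃ k x y : ℤ, Odd k ∧
      k * i = 2 ^ M * (l' * x - a' * y) ∧ k * j = 2 ^ M * (l' * y - a' * x))
    -- the Euler-system data at `λ`
    {τ₀ : absoluteGaloisGroup K}
    (hτ₀ : τ₀ ∈ (v.primeBelow (closureEmb (K := K) (v.adicCompletion K)) 𝔐).inertia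
      (absoluteGaloisGroup K))
    (hIτ₀ : ∀ τ ∈ (v.primeBelow (closureEmb (K := K) (v.adicCompletion K)) 𝔐).inertia
      (absoluteGaloisGroup K), ∃ i : ℕ, ∀ x ∈ A₁, τ • x = (τ₀ ^ i) • x)
    {R₀ : geomPoints W} (hR₀A : R₀ ∈ A₁) (hR₀ : ((2 ^ M : ℕ) : ℤ) • R₀ = τ₀ • P₁ - P₁)
    (hR₀red : red R₀ = l' • φ (red P₂) - a' • red P₂)
    (hFP₂ : F • P₂ = P₂)
    (hsel₂ : kolyvaginClass W _ hdiv hA₂ P₂ hP₂ ∈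
      selmerLocalKer W (v.adicCompletion K) ((2 ^ M : ℕ) : ℤ))
    (k : ℤ) :
    k • kolyvaginClass W _ hdiv hA₁ P₁ hP₁ ∈ selmerLocalKer W (v.adicCompletion K) ((2 ^ M : ℕ) : ℤ) ↔
      k • kolyvaginClass W _ hdiv hA₂ P₂ hP₂ ∈
        W.torsionLocalKer (v.adicCompletion K) ((2 ^ M : ℕ) : ℤ) := by
  exact SylvesterTwoUpper.zsmul_kolyvaginClass_mem_selmerLocalKer_iff_mem_torsionLocalKer_of_kerChi W Nat.prime_two
    hA₁ hA₂ hP₁ hP₂ hgood hpv h𝔐 hF hFfix hsurj red φ hredI hredF hred hBn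
    (fun b hb ↦ kerChi_two_of_relations φ htors hl' ha' hchar hne hg hg2 hgen hrel b hb) hτ₀ hIτ₀ hR₀A hR₀ hR₀red hFP₂ hsel₂ k

end RamifiedTwoRegular

end Summit.BirchSwinnertonDyer.BirchSwinnertonDyer.Theorems.OffBigImageOddLocalAtTwo.Engine

end
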